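import Summits.HubbardSuperconductivity.HubbardSuperconductivity.Theorems.NodalWardXYNodalPropagatorDecayProfile

/-!
# Nodal propagator decay (route `NodalWardXY`, item `NodalPropagatorDecay`): I-b. the profile and its bounds

Continuation of `NodalWardXYNodalPropagatorDecayProfile`: the profile
`prof⟪l,α,β,γ,s⟫ = e^{-lρ(s)} (γ + (α + βs)/ρ(s))` as the product `P0 · Q0` of the two factors
studied there, its first three derivatives `prof1, prof2, prof3` (Leibniz rule, `HasDerivAt`),
their continuity, and the pointwise bounds `|prof_k| ≤ c_k · maj⟪l,s⟫` with the common majorant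
`maj⟪l,s⟫ = (l + l² + l³) e^{-lρ(s)} + 1/ρ(s)²` (`c₁ = 3`, `c₂ = 7`, `c₃ = 42`), which is integrable
on `ℝ` uniformly in `l ≥ 0`.  All objects are local notations for closed terms (no definitions).
Pure calculus; no physics.
-/

noncomputable section

namespace Summit.HubbardSuperconductivity.HubbardSuperconductivity.Theorems

namespace NodalDecay

open Real

/-! ### Notation (local; every file of this proof re-declares the same abbreviations)

No definitions are introduced: `ρ⟪s⟫ = √(1+s²)`, `θ = s/ρ`, `θ1 = 1/ρ³`, `θ2 = -3s/ρ⁵`,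
`P0⟪l,s⟫ = e^{-lρ}` with its derivatives `P1, P2, P3`, `Q0⟪α,β,γ,s⟫ = γ + (α+βs)/ρ` with its
derivatives `Q1, Q2, Q3` are LOCAL NOTATIONS for explicit closed terms. -/

local notation "ρ⟪" s "⟫" => Real.sqrt (1 + s ^ 2)
local notation "θ⟪" s "⟫" => s / ρ⟪s⟫
local notation "θ1⟪" s "⟫" => 1 / ρ⟪s⟫ ^ 3
local notation "θ2⟪" s "⟫" => -3 * s / ρ⟪s⟫ ^ 5
local notation "P0⟪" l ", " s "⟫" => Real.exp (-(l * ρ⟪s⟫))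
local notation "P1⟪" l ", " s "⟫" => -l * θ⟪s⟫ * P0⟪l, s⟫
local notation "P2⟪" l ", " s "⟫" => (-l * θ1⟪s⟫ + l ^ 2 * θ⟪s⟫ ^ 2) * P0⟪l, s⟫
local notation "P3⟪" l ", " s "⟫" =>
  (-l * θ2⟪s⟫ + 3 * l ^ 2 * θ⟪s⟫ * θ1⟪s⟫ - l ^ 3 * θ⟪s⟫ ^ 3) * P0⟪l, s⟫
local notation "Q0⟪" α ", " β ", " γ ", " s "⟫" => γ + (α + β * s) / ρ⟪s⟫
local notation "Q1⟪" α ", " β ", " s "⟫" => (β - α * s) / ρ⟪s⟫ ^ 3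
local notation "Q2⟪" α ", " β ", " s "⟫" => -α / ρ⟪s⟫ ^ 3 - 3 * s * (β - α * s) / ρ⟪s⟫ ^ 5
local notation "Q3⟪" α ", " β ", " s "⟫" =>
  (9 * α * s - 3 * β) / ρ⟪s⟫ ^ 5 + 15 * s ^ 2 * (β - α * s) / ρ⟪s⟫ ^ 7
local notation "prof⟪" l ", " α ", " β ", " γ ", " s "⟫" => P0⟪l, s⟫ * Q0⟪α, β, γ, s⟫
local notation "prof1⟪" l ", " α ", " β ", " γ ", " s "⟫" =>
  P1⟪l, s⟫ * Q0⟪α, β, γ, s⟫ + P0⟪l, s⟫ * Q1⟪α, β, s⟫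
local notation "prof2⟪" l ", " α ", " β ", " γ ", " s "⟫" =>
  P2⟪l, s⟫ * Q0⟪α, β, γ, s⟫ + 2 * (P1⟪l, s⟫ * Q1⟪α, β, s⟫) + P0⟪l, s⟫ * Q2⟪α, β, s⟫
local notation "prof3⟪" l ", " α ", " β ", " γ ", " s "⟫" =>
  P3⟪l, s⟫ * Q0⟪α, β, γ, s⟫ + 3 * (P2⟪l, s⟫ * Q1⟪α, β, s⟫) + 3 * (P1⟪l, s⟫ * Q2⟪α, β, s⟫)
    + P0⟪l, s⟫ * Q3⟪α, β, s⟫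
local notation "maj⟪" l ", " s "⟫" => (l + l ^ 2 + l ^ 3) * P0⟪l, s⟫ + 1 / ρ⟪s⟫ ^ 2

/-! ### The profile and its first three derivatives -/

/-- `prof' = prof1`. -/
theorem hasDerivAt_prof (l α β γ s : ℝ) : HasDerivAt (fun x => prof⟪l, α, β, γ, x⟫) (prof1⟪l, α, β, γ, s⟫) s :=
  ((hasDerivAt_P0 l s).fun_mul (hasDerivAt_Q0 α β γ s)).congr_deriv rfl

/-- `prof1' = prof2`. -/
theorem hasDerivAt_prof1 (l α β γ s : ℝ) : HasDerivAt (fun x => prof1⟪l, α, β, γ, x⟫) (prof2⟪l, α, β, γ, s⟫) s := by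
  refine (((hasDerivAt_P1 l s).fun_mul (hasDerivAt_Q0 α β γ s)).fun_add
    ((hasDerivAt_P0 l s).fun_mul (hasDerivAt_Q1 α β s))).congr_deriv ?_
  ring

/-- `prof2' = prof3`. -/
theorem hasDerivAt_prof2 (l α β γ s : ℝ) : HasDerivAt (fun x => prof2⟪l, α, β, γ, x⟫) (prof3⟪l, α, β, γ, s⟫) s := by
  refine ((((hasDerivAt_P2 l s).fun_mul (hasDerivAt_Q0 α β γ s)).fun_add
    (((hasDerivAt_P1 l s).fun_mul (hasDerivAt_Q1 α β s)).const_mul 2)).fun_add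
    ((hasDerivAt_P0 l s).fun_mul (hasDerivAt_Q2 α β s))).congr_deriv ?_
  ring

/-- Continuity of `P₀`. -/
theorem continuous_P0 (l : ℝ) : Continuous fun x => P0⟪l, x⟫ := by
  have := continuous_rho
  show Continuous fun s => P0⟪l, s⟫
  fun_prop

/-- Continuity of `θ`, `θ₁`, `θ₂`. -/
theorem continuous_th : (Continuous fun x => θ⟪x⟫) ∧ (Continuous fun x => θ1⟪x⟫) ∧ (Continuous fun x => θ2⟪x⟫) := by
  have hc := continuous_rho
  have hne : ∀ s, ρ⟪s⟫ ≠ 0 := fun s => (rho_pos s).ne'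
  refine ⟨?_, ?_, ?_⟩
  · exact continuous_id.div hc hne
  · exact continuous_const.div (hc.pow 3) (fun s => pow_ne_zero 3 (rho_pos s).ne')
  · show Continuous fun s => -3 * s / ρ⟪s⟫ ^ 5
    exact (continuous_const.mul continuous_id).div (hc.pow 5)
      (fun s => pow_ne_zero 5 (rho_pos s).ne')

/-- Continuity of `P₁, P₂, P₃`. -/
theorem continuous_P123 (l : ℝ) : (Continuous fun x => P1⟪l, x⟫) ∧ (Continuous fun x => P2⟪l, x⟫) ∧ (Continuous fun x => P3⟪l, x⟫) := by
  obtain ⟨h0, h1, h2⟩ := continuous_th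
  have hP := continuous_P0 l
  refine ⟨?_, ?_, ?_⟩
  · show Continuous fun s => -l * θ⟪s⟫ * P0⟪l, s⟫
    fun_prop
  · show Continuous fun s => (-l * θ1⟪s⟫ + l ^ 2 * θ⟪s⟫ ^ 2) * P0⟪l, s⟫
    fun_prop
  · show Continuous fun s => (-l * θ2⟪s⟫ + 3 * l ^ 2 * θ⟪s⟫ * θ1⟪s⟫ - l ^ 3 * θ⟪s⟫ ^ 3) * P0⟪l, s⟫
    fun_prop

/-- Continuity of `Q₀, Q₁, Q₂, Q₃`. -/
theorem continuous_Q (α β γ : ℝ) : (Continuous fun x => Q0⟪α, β, γ, x⟫) ∧ (Continuous fun x => Q1⟪α, β, x⟫) ∧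
    (Continuous fun x => Q2⟪α, β, x⟫) ∧ (Continuous fun x => Q3⟪α, β, x⟫) := by
  have hc := continuous_rho
  have hne : ∀ n : ℕ, ∀ s, ρ⟪s⟫ ^ n ≠ 0 := fun n s => pow_ne_zero n (rho_pos s).ne'
  refine ⟨?_, ?_, ?_, ?_⟩
  · show Continuous fun s => γ + (α + β * s) / ρ⟪s⟫
    exact continuous_const.add ((by fun_prop : Continuous fun s : ℝ => α + β * s).div hc
      (fun s => (rho_pos s).ne'))
  · show Continuous fun s => (β - α * s) / ρ⟪s⟫ ^ 3
    exact (by fun_prop : Continuous fun s : ℝ => β - α * s).div (hc.pow 3) (hne 3)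
  · show Continuous fun s => -α / ρ⟪s⟫ ^ 3 - 3 * s * (β - α * s) / ρ⟪s⟫ ^ 5
    exact ((continuous_const).div (hc.pow 3) (hne 3)).sub
      ((by fun_prop : Continuous fun s : ℝ => 3 * s * (β - α * s)).div (hc.pow 5) (hne 5))
  · show Continuous fun s => (9 * α * s - 3 * β) / ρ⟪s⟫ ^ 5 + 15 * s ^ 2 * (β - α * s) / ρ⟪s⟫ ^ 7
    exact ((by fun_prop : Continuous fun s : ℝ => 9 * α * s - 3 * β).div (hc.pow 5) (hne 5)).add
      ((by fun_prop : Continuous fun s : ℝ => 15 * s ^ 2 * (β - α * s)).div (hc.pow 7) (hne 7))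

/-- Continuity of the profile and its three derivatives. -/
theorem continuous_prof (l α β γ : ℝ) : (Continuous fun x => prof⟪l, α, β, γ, x⟫) ∧
    (Continuous fun x => prof1⟪l, α, β, γ, x⟫) ∧ (Continuous fun x => prof2⟪l, α, β, γ, x⟫) ∧
    (Continuous fun x => prof3⟪l, α, β, γ, x⟫) := by
  obtain ⟨hP1, hP2, hP3⟩ := continuous_P123 l
  have hP0 := continuous_P0 l
  obtain ⟨hQ0, hQ1, hQ2, hQ3⟩ := continuous_Q α β γ
  refine ⟨?_, ?_, ?_, ?_⟩
  · show Continuous fun s => P0⟪l, s⟫ * Q0⟪α, β, γ, s⟫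
    fun_prop
  · show Continuous fun s => P1⟪l, s⟫ * Q0⟪α, β, γ, s⟫ + P0⟪l, s⟫ * Q1⟪α, β, s⟫
    fun_prop
  · show Continuous fun s => P2⟪l, s⟫ * Q0⟪α, β, γ, s⟫ + 2 * (P1⟪l, s⟫ * Q1⟪α, β, s⟫) + P0⟪l, s⟫ * Q2⟪α, β, s⟫
    fun_prop
  · show Continuous fun s =>
      P3⟪l, s⟫ * Q0⟪α, β, γ, s⟫ + 3 * (P2⟪l, s⟫ * Q1⟪α, β, s⟫) + 3 * (P1⟪l, s⟫ * Q2⟪α, β, s⟫) + P0⟪l, s⟫ * Q3⟪α, β, s⟫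
    fun_prop

/-! ### Pointwise bounds by the common majorant `(l + l² + l³) P₀ + 1/ρ²` -/

/-- `1/ρ² ≤ 1`. -/
theorem inv_rho_sq_le_one (s : ℝ) : 1 / ρ⟪s⟫ ^ 2 ≤ 1 := by
  rw [div_le_one (pow_pos (rho_pos s) 2)]
  exact one_le_pow₀ (one_le_rho s)

/-- `|ab| ≤ AB` from `|a| ≤ A`, `|b| ≤ B`. -/
theorem abs_mul_le_mul {a b A B : ℝ} (ha : |a| ≤ A) (hb : |b| ≤ B) : |a * b| ≤ A * B := by
  rw [abs_mul]; exact mul_le_mul ha hb (abs_nonneg b) ((abs_nonneg a).trans ha)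

/-- `|prof| ≤ 3` (for `l ≥ 0`, `|α|,|β|,|γ| ≤ 1`). -/
theorem abs_prof_le {l α β γ : ℝ} (hl : 0 ≤ l) (hα : |α| ≤ 1) (hβ : |β| ≤ 1) (hγ : |γ| ≤ 1)
    (s : ℝ) : |prof⟪l, α, β, γ, s⟫| ≤ 3 := by
  have h1 : |P0⟪l, s⟫| ≤ 1 := by rw [abs_of_pos (P0_pos l s)]; exact P0_le_one hl s
  have h2 := abs_Q0_le hα hβ hγ s
  simpa using abs_mul_le_mul h1 h2

/-- `|prof1| ≤ 3 · maj`. -/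
theorem abs_prof1_le {l α β γ : ℝ} (hl : 0 ≤ l) (hα : |α| ≤ 1) (hβ : |β| ≤ 1) (hγ : |γ| ≤ 1)
    (s : ℝ) : |prof1⟪l, α, β, γ, s⟫| ≤ 3 * maj⟪l, s⟫ := by
  have hP0 := P0_pos l s
  have hP0' : |P0⟪l, s⟫| ≤ 1 := by rw [abs_of_pos hP0]; exact P0_le_one hl s
  have hρ2 : 0 ≤ 1 / ρ⟪s⟫ ^ 2 := by positivity
  have e1 := abs_mul_le_mul (abs_P1_le hl s) (abs_Q0_le hα hβ hγ s)
  have e2 := abs_mul_le_mul hP0' (abs_Q1_le hα hβ s)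
  calc |P1⟪l, s⟫ * Q0⟪α, β, γ, s⟫ + P0⟪l, s⟫ * Q1⟪α, β, s⟫|
      ≤ |P1⟪l, s⟫ * Q0⟪α, β, γ, s⟫| + |P0⟪l, s⟫ * Q1⟪α, β, s⟫| := abs_add_le _ _
    _ ≤ l * P0⟪l, s⟫ * 3 + 1 * (2 / ρ⟪s⟫ ^ 2) := add_le_add e1 e2
    _ = 3 * (l * P0⟪l, s⟫) + 2 * (1 / ρ⟪s⟫ ^ 2) := by ring
    _ ≤ 3 * ((l + l ^ 2 + l ^ 3) * P0⟪l, s⟫) + 3 * (1 / ρ⟪s⟫ ^ 2) := by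
        gcongr
        · nlinarith [sq_nonneg l, pow_pos hP0 1, mul_nonneg (sq_nonneg l) hl]
        · norm_num
    _ = 3 * ((l + l ^ 2 + l ^ 3) * P0⟪l, s⟫ + 1 / ρ⟪s⟫ ^ 2) := by ring

/-- `|prof2| ≤ 7 · maj`. -/
theorem abs_prof2_le {l α β γ : ℝ} (hl : 0 ≤ l) (hα : |α| ≤ 1) (hβ : |β| ≤ 1) (hγ : |γ| ≤ 1)
    (s : ℝ) : |prof2⟪l, α, β, γ, s⟫| ≤ 7 * maj⟪l, s⟫ := by
  have hP0 := P0_pos l s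
  have hP0' : |P0⟪l, s⟫| ≤ 1 := by rw [abs_of_pos hP0]; exact P0_le_one hl s
  have hρ2 : 0 ≤ 1 / ρ⟪s⟫ ^ 2 := by positivity
  have hQ1' : |Q1⟪α, β, s⟫| ≤ 2 := (abs_Q1_le hα hβ s).trans (by
    have := inv_rho_sq_le_one s; rw [div_eq_mul_one_div]; linarith)
  have e1 := abs_mul_le_mul (abs_P2_le hl s) (abs_Q0_le hα hβ hγ s)
  have e2 := abs_mul_le_mul (abs_P1_le hl s) hQ1'
  have e3 := abs_mul_le_mul hP0' (abs_Q2_le hα hβ s)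
  calc |P2⟪l, s⟫ * Q0⟪α, β, γ, s⟫ + 2 * (P1⟪l, s⟫ * Q1⟪α, β, s⟫) + P0⟪l, s⟫ * Q2⟪α, β, s⟫|
      ≤ |P2⟪l, s⟫ * Q0⟪α, β, γ, s⟫| + |2 * (P1⟪l, s⟫ * Q1⟪α, β, s⟫)| + |P0⟪l, s⟫ * Q2⟪α, β, s⟫| :=
        abs_add_three _ _ _
    _ = |P2⟪l, s⟫ * Q0⟪α, β, γ, s⟫| + 2 * |P1⟪l, s⟫ * Q1⟪α, β, s⟫| + |P0⟪l, s⟫ * Q2⟪α, β, s⟫| := by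
        rw [abs_mul (2:ℝ), show |(2:ℝ)| = 2 by norm_num]
    _ ≤ (l + l ^ 2) * P0⟪l, s⟫ * 3 + 2 * (l * P0⟪l, s⟫ * 2) + 1 * (7 / ρ⟪s⟫ ^ 2) := by
        gcongr
    _ = (7 * l + 3 * l ^ 2) * P0⟪l, s⟫ + 7 * (1 / ρ⟪s⟫ ^ 2) := by ring
    _ ≤ 7 * ((l + l ^ 2 + l ^ 3) * P0⟪l, s⟫) + 7 * (1 / ρ⟪s⟫ ^ 2) := by
        gcongr ?_ + _
        nlinarith [sq_nonneg l, mul_nonneg (sq_nonneg l) hl, mul_nonneg (mul_nonneg (sq_nonneg l) hl) hP0.le,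
          mul_nonneg (sq_nonneg l) hP0.le]
    _ = 7 * ((l + l ^ 2 + l ^ 3) * P0⟪l, s⟫ + 1 / ρ⟪s⟫ ^ 2) := by ring

/-- `|prof3| ≤ 42 · maj`. -/
theorem abs_prof3_le {l α β γ : ℝ} (hl : 0 ≤ l) (hα : |α| ≤ 1) (hβ : |β| ≤ 1) (hγ : |γ| ≤ 1)
    (s : ℝ) : |prof3⟪l, α, β, γ, s⟫| ≤ 42 * maj⟪l, s⟫ := by
  have hP0 := P0_pos l s
  have hP0' : |P0⟪l, s⟫| ≤ 1 := by rw [abs_of_pos hP0]; exact P0_le_one hl s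
  have hρ2 : 0 ≤ 1 / ρ⟪s⟫ ^ 2 := by positivity
  have hrr := inv_rho_sq_le_one s
  have hQ1' : |Q1⟪α, β, s⟫| ≤ 2 := (abs_Q1_le hα hβ s).trans (by rw [div_eq_mul_one_div]; linarith)
  have hQ2' : |Q2⟪α, β, s⟫| ≤ 7 := (abs_Q2_le hα hβ s).trans (by rw [div_eq_mul_one_div]; linarith)
  have e1 := abs_mul_le_mul (abs_P3_le hl s) (abs_Q0_le hα hβ hγ s)
  have e2 := abs_mul_le_mul (abs_P2_le hl s) hQ1'
  have e3 := abs_mul_le_mul (abs_P1_le hl s) hQ2'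
  have e4 := abs_mul_le_mul hP0' (abs_Q3_le hα hβ s)
  calc |P3⟪l, s⟫ * Q0⟪α, β, γ, s⟫ + 3 * (P2⟪l, s⟫ * Q1⟪α, β, s⟫) + 3 * (P1⟪l, s⟫ * Q2⟪α, β, s⟫) + P0⟪l, s⟫ * Q3⟪α, β, s⟫|
      ≤ |P3⟪l, s⟫ * Q0⟪α, β, γ, s⟫ + 3 * (P2⟪l, s⟫ * Q1⟪α, β, s⟫) + 3 * (P1⟪l, s⟫ * Q2⟪α, β, s⟫)|
          + |P0⟪l, s⟫ * Q3⟪α, β, s⟫| := abs_add_le _ _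
    _ ≤ (|P3⟪l, s⟫ * Q0⟪α, β, γ, s⟫| + |3 * (P2⟪l, s⟫ * Q1⟪α, β, s⟫)| + |3 * (P1⟪l, s⟫ * Q2⟪α, β, s⟫)|)
          + |P0⟪l, s⟫ * Q3⟪α, β, s⟫| := by gcongr; exact abs_add_three _ _ _
    _ = |P3⟪l, s⟫ * Q0⟪α, β, γ, s⟫| + 3 * |P2⟪l, s⟫ * Q1⟪α, β, s⟫| + 3 * |P1⟪l, s⟫ * Q2⟪α, β, s⟫|
          + |P0⟪l, s⟫ * Q3⟪α, β, s⟫| := by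
        rw [abs_mul (3:ℝ), abs_mul (3:ℝ), show |(3:ℝ)| = 3 by norm_num]
    _ ≤ (3 * l + 3 * l ^ 2 + l ^ 3) * P0⟪l, s⟫ * 3 + 3 * ((l + l ^ 2) * P0⟪l, s⟫ * 2)
          + 3 * (l * P0⟪l, s⟫ * 7) + 1 * (42 / ρ⟪s⟫ ^ 2) := by
        gcongr
    _ = (36 * l + 15 * l ^ 2 + 3 * l ^ 3) * P0⟪l, s⟫ + 42 * (1 / ρ⟪s⟫ ^ 2) := by ring
    _ ≤ 42 * ((l + l ^ 2 + l ^ 3) * P0⟪l, s⟫) + 42 * (1 / ρ⟪s⟫ ^ 2) := by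
        gcongr ?_ + _
        nlinarith [sq_nonneg l, mul_nonneg (sq_nonneg l) hl,
          mul_nonneg (mul_nonneg (sq_nonneg l) hl) hP0.le, mul_nonneg (sq_nonneg l) hP0.le,
          mul_nonneg hl hP0.le]
    _ = 42 * ((l + l ^ 2 + l ^ 3) * P0⟪l, s⟫ + 1 / ρ⟪s⟫ ^ 2) := by ring

end NodalDecay

end Summit.HubbardSuperconductivity.HubbardSuperconductivity.Theorems
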